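import Literature.NumberTheory.GaloisRepresentations.LocalKroneckerWeberInertiaProofs
import Literature.NumberTheory.GaloisRepresentations.PadicAlgebraDegreeOnePlace
import Literature.NumberTheory.EllipticCurves.IwasawaSelmerProofs
import Literature.NumberTheory.EllipticCurves.DiscreteH1Equiv
import Literature.NumberTheory.EllipticCurves.GeomPointsGaloisModule
import HarnessLib

/-!
# The local condition over `K_∞` at a place with ONE prime above it is conjugation-stable
# (cell `b2b-bsdres`, unit `b2b-bsdres-eisenstein-p1`, gen 19; X1R0-GAPMAP §28, memo
# `V76-LOCAL-TERM-PLAN.md` §4.5 route R1′, step (P1))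

HONEST FRAMING (run/shared/lean/b2b/bsd-rank1-residual/, verbatim in every file): the goal of the
cell is to DELETE the COMBINATION-SHAPED residual classes of the Birch–Swinnerton-Dyer formula for
ALL analytic-rank `≤ 1` elliptic curves over `ℚ` — "full BSD formula for every rank `≤ 1` curve in
class `C`" assembled STRICTLY from published theorems — so that the rank-`≤ 1` remainder becomes
exactly the CONSTRUCTION-SHAPED classes, which are TYPED (missing-input `Prop`s), NOT attempted.
This is not "finishing BSD". Sub-cell `b2b-bsdres-eisenstein-p1`: research route; NO CLAIM BEYOND
STATED CLASSES; nothing here changes a label; nothing is booked. THEOREMS ONLY — no definition, no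
named fact, nothing asserted about any particular curve.

## What and why

Route R1′ for the local term `a` at layer `n` (memo §4.5) counts classes over `ℚ_n` AFTER transport
to `H¹(ℚ_∞, E[p^∞])` (`kerH1Iso`), where membership in `Sel_{p^∞}(E/ℚ_∞)`
(`WeierstrassCurve.selmerGroupOver`) asks the local condition at `v` for EVERY conjugate
`conj_σ c`, `σ ∈ Γ_ℚ` (all places of `ℚ_∞` above `v`). The socket at `p` (FILE 21,
`X1/StrictAtPOfInertiaTransported`) delivers the condition for the class `c` itself at the chosen
place. This file closes the gap at `p`:

* §1 (any field `K`, any `H ⊴ Γ_K`, any `K`-algebra `E`): conjugation by an element of the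
  DECOMPOSITION GROUP of the chosen embedding preserves the local kernel —
  `localResOver (conj_{res d} c) = conj_d (localResOver c)` (`localResOver_conjH1_resGal`, both sides
  are maps of one compatible pair), hence
  **`(localKerOver E).comap (conj_{res d}) = localKerOver E`** (`comap_conjH1_resGal_localKerOver`).
* §2 (`K = ℚ`, `κ` the cyclotomic `ℤ_p`-extension, `v ∋ p`): `χ_p(I_{ℚ_v}) = ℤ_pˣ` (tree, Serre
  *Local Fields* IV §4 Prop. 17: `ℚ_p(μ_{p^∞})/ℚ_p` totally ramified) and `ker κ = χ_p⁻¹(μ(ℤ_p))`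
  give **`Γ_ℚ = res(I_{ℚ_v}) · ker κ`** (`exists_absInertia_mul_mem_kerSubgroup`): there is ONE
  place of `ℚ_∞` above `p`.
* §3: hence for every class `c ∈ H¹(Gal(ℚ̄/ℚ_∞), E[p^∞])` Kummer at the chosen place above `p`,
  ALL conjugates `conj_σ c`, `σ ∈ Γ_ℚ`, are (`conjH1_mem_localKerOver_of_mem`; inner automorphisms
  act trivially, `conjH1_of_mem`) — the `p`-part of `Sel_{p^∞}(E/ℚ_∞)`-membership in route R1′.

References: [SerreLocalFields1979] IV §4 Prop. 17, VII §5 Prop. 3; [SerreGaloisCohomology1997]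
I.§2.5, II.§1.1; [GreenbergLNM1716] §2; [Washington1997] §13.1.
-/

set_option autoImplicit false

noncomputable section

open scoped Classical

universe u

open Function Field NumberField IsDedekindDomain WeierstrassCurve
  Literature.NumberTheory.EllipticCurves Literature.NumberTheory.GaloisRepresentations

namespace Summit.BirchSwinnertonDyer.Rank1Residual.X1.LocalKerOverAtPConj

/-! ## §1. Conjugation by the decomposition group preserves the local kernel -/

section General

variable {K : Type u} [Field K] (W : WeierstrassCurve K) (p : ℕ)
  (H : Subgroup (absoluteGaloisGroup K)) [hH : H.Normal] (E : Type u) [Field E] [Algebra K E]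

/-- The local subgroup `H_E = res⁻¹(H) ≤ Γ_E` of a normal `H ⊴ Γ_K` is normal. [folklore] -/
theorem localSubgroup_normal : (localSubgroup H E).Normal := by
  change (H.comap (resGalOfEmb (closureEmb (K := K) E)).toMonoidHom).Normal
  infer_instance

/-- **`localResOver ∘ conj_{res d} = conj_d ∘ localResOver`** for `d ∈ Γ_E`: both composites are
the map of the compatible pair `(τ ↦ res(d⁻¹ τ d) : H_E → H, P ↦ d • ι_* P)` (`resGal` is a
homomorphism; `pointsMap_smul`). [cite: SerreGaloisCohomology1997, I.§2.5, II.§1.1] -/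
theorem localResOver_conjH1_resGal (d : absoluteGaloisGroup E) (c : W.subgroupH1 p H) :
    W.localResOver p H E (W.conjH1 p H (resGal (K := K) E d) c) =
      @Literature.NumberTheory.EllipticCurves.conjH1 _ _ _ _ (localSubgroup H E) (localPoints W E)
        _ _ _ _ (localSubgroup_normal H E) d (W.localResOver p H E c) := by
  haveI := localSubgroup_normal H E
  rw [WeierstrassCurve.localResOver, localResOverOfEmb_eq]
  change resH1Hom _ _ _ (resH1Hom (subgroupConj H _)
      (DistribSMul.toAddMonoidHom (geomPrimaryTorsion W p) _) _ c) =
    resH1Hom (subgroupConj (localSubgroup H E) d) (DistribSMul.toAddMonoidHom (localPoints W E) d) _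
      (resH1Hom _ _ _ c)
  rw [resH1Hom_resH1Hom, resH1Hom_resH1Hom]
  refine DFunLike.congr_fun (resH1Hom_congr ?_ ?_ _ _) c
  · refine ContinuousMonoidHom.ext fun τ ↦ Subtype.ext ?_
    change (resGal (K := K) E d)⁻¹ * resGalOfEmb (closureEmb (K := K) E) (τ : absoluteGaloisGroup E) *
        resGal (K := K) E d =
      resGalOfEmb (closureEmb (K := K) E) (d⁻¹ * (τ : absoluteGaloisGroup E) * d)
    change (resGal (K := K) E d)⁻¹ * resGal (K := K) E (τ : absoluteGaloisGroup E) *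
        resGal (K := K) E d = resGal (K := K) E (d⁻¹ * (τ : absoluteGaloisGroup E) * d)
    rw [map_mul, map_mul, map_inv]
  · refine AddMonoidHom.ext fun P ↦ ?_
    change pointsMap W E (((resGal (K := K) E d • P : geomPrimaryTorsion W p) : W.geomPoints)) =
      d • pointsMap W E ((P : geomPrimaryTorsion W p) : W.geomPoints)
    rw [Literature.NumberTheory.EllipticCurves.primaryComponent.coe_smul, pointsMap_smul]

/-- **Conjugation by the decomposition group preserves the local kernel**:
`(localKerOver E).comap (conj_{res d}) = localKerOver E` for every `d ∈ Γ_E` (§1's intertwining and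
`conj_{d⁻¹} ∘ conj_d = id` on the local side). [cite: SerreGaloisCohomology1997, II.§1.1]
[cite: GreenbergLNM1716, §2] -/
theorem comap_conjH1_resGal_localKerOver (d : absoluteGaloisGroup E) :
    (W.localKerOver p H E).comap (W.conjH1 p H (resGal (K := K) E d)) = W.localKerOver p H E := by
  haveI := localSubgroup_normal H E
  ext c
  rw [AddSubgroup.mem_comap, WeierstrassCurve.mem_localKerOver_iff,
    WeierstrassCurve.mem_localKerOver_iff, localResOver_conjH1_resGal]
  constructor
  · intro h
    have h' := congrArg (Literature.NumberTheory.EllipticCurves.conjH1 (localSubgroup H E)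
      (localPoints W E) d⁻¹) h
    rwa [map_zero, ← AddMonoidHom.comp_apply,
      ← conjH1_mul_holds (localSubgroup H E) (localPoints W E) d⁻¹ d, inv_mul_cancel,
      conjH1_one_holds (localSubgroup H E) (localPoints W E), AddMonoidHom.id_apply] at h'
  · intro h
    rw [h, map_zero]

/-- Pointwise form: `conj_{res d} c ∈ localKerOver E ↔ c ∈ localKerOver E`.
[cite: SerreGaloisCohomology1997, II.§1.1] -/
theorem conjH1_resGal_mem_localKerOver_iff (d : absoluteGaloisGroup E) (c : W.subgroupH1 p H) :
    W.conjH1 p H (resGal (K := K) E d) c ∈ W.localKerOver p H E ↔ c ∈ W.localKerOver p H E := by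
  rw [← AddSubgroup.mem_comap, comap_conjH1_resGal_localKerOver]

/-- **If `Γ_K = res(Γ_E) · H` then the local kernel at `E` is stable under ALL of `Γ_K`**: for
`σ = res(d) · h`, `conj_σ = conj_{res d} ∘ conj_h` (`conjH1_mul`) and `conj_h = id` (`conjH1_of_mem`,
inner automorphisms). [cite: SerreLocalFields1979, VII §5 Prop. 3]
[cite: SerreGaloisCohomology1997, II.§1.1] -/
theorem conjH1_mem_localKerOver_of_exists (σ : absoluteGaloisGroup K)
    (hσ : ∃ d : absoluteGaloisGroup E, (resGal (K := K) E d)⁻¹ * σ ∈ H)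
    {c : W.subgroupH1 p H} (hc : c ∈ W.localKerOver p H E) :
    W.conjH1 p H σ c ∈ W.localKerOver p H E := by
  obtain ⟨d, hd⟩ := hσ
  have hσeq : σ = resGal (K := K) E d * ((resGal (K := K) E d)⁻¹ * σ) := by
    rw [mul_inv_cancel_left]
  rw [hσeq, W.conjH1_mul_holds p H, AddMonoidHom.comp_apply, W.conjH1_of_mem_holds p H hd,
    AddMonoidHom.id_apply, conjH1_resGal_mem_localKerOver_iff]
  exact hc

end General

/-! ## §2. `Γ_ℚ = res(I_{ℚ_v}) · Gal(ℚ̄/ℚ_∞)` for the cyclotomic tower and `v ∋ p` -/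

section Rat

variable {p : ℕ} [hp : Fact p.Prime] (κ : ZpExtension ℚ p) {v : HeightOneSpectrum (𝓞 ℚ)}

/-- **There is one place of `ℚ_∞^{cyc}` above `p`: `Γ_ℚ = res(I_{ℚ_v}) · ker κ`.** For every
`σ ∈ Γ_ℚ` there is `d` in the inertia group of `ℚ_v` (`v ∋ p`) with `res(d)⁻¹ σ ∈ ker κ`: choose `d`
with `χ_p(d) = χ_p(σ)` (`χ_p(I_{ℚ_v}) = ℤ_pˣ`, tree
`adicCompletion_rat_exists_mem_absInertia_cyclotomicCharacter_eq`; `χ_p ∘ res = χ_p`); then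
`χ_p(res(d)⁻¹ σ) = 1 ∈ μ(ℤ_p)` and `ker κ = χ_p⁻¹(μ(ℤ_p))` (`κ` cyclotomic).
[cite: SerreLocalFields1979, Ch. IV §4 Prop. 17] [cite: Washington1997, §13.1] -/
theorem exists_absInertia_mul_mem_kerSubgroup (hκ : κ.IsCyclotomic)
    (hpv : ((p : ℕ) : 𝓞 ℚ) ∈ v.asIdeal) (σ : absoluteGaloisGroup ℚ) :
    ∃ d ∈ absInertia (v.adicCompletion ℚ),
      (absGaloisRestrict ℚ (v.adicCompletion ℚ) d)⁻¹ * σ ∈ κ.kerSubgroup := by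
  have hv : (Rat.HeightOneSpectrum.primesEquiv v : ℕ) = p :=
    LocalField.primesEquiv_eq_of_natCast_mem p v hpv
  obtain ⟨d, hdI, hd⟩ := adicCompletion_rat_exists_mem_absInertia_cyclotomicCharacter_eq p v hv
    (GaloisRep.cyclotomicCharacter ℚ p σ)
  refine ⟨d, hdI, ?_⟩
  rw [hκ, Subgroup.mem_comap]
  change GaloisRep.cyclotomicCharacter ℚ p ((absGaloisRestrict ℚ (v.adicCompletion ℚ) d)⁻¹ * σ) ∈
    CommGroup.torsion ℤ_[p]ˣ
  rw [map_mul, map_inv, cyclotomicCharacter_absGaloisRestrict, hd, inv_mul_cancel]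
  exact one_mem _

/-- The same with the tree's `resGal` (`= absGaloisRestrict`, `resGal_eq_absGaloisRestrict`) and
without the inertia datum. [cite: SerreLocalFields1979, Ch. IV §4 Prop. 17] -/
theorem exists_resGal_inv_mul_mem_kerSubgroup (hκ : κ.IsCyclotomic)
    (hpv : ((p : ℕ) : 𝓞 ℚ) ∈ v.asIdeal) (σ : absoluteGaloisGroup ℚ) :
    ∃ d : absoluteGaloisGroup (v.adicCompletion ℚ),
      (resGal (K := ℚ) (v.adicCompletion ℚ) d)⁻¹ * σ ∈ κ.kerSubgroup := by
  obtain ⟨d, -, hd⟩ := exists_absInertia_mul_mem_kerSubgroup κ hκ hpv σ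
  exact ⟨d, by rwa [resGal_eq_absGaloisRestrict]⟩

/-! ## §3. The local condition at `p` over `ℚ_∞` holds for all conjugates -/

variable (W : WeierstrassCurve ℚ) (p)

/-- **At `v ∋ p`, for the cyclotomic tower, `c ∈ localKerOver ℚ_v` implies
`conj_σ c ∈ localKerOver ℚ_v` for every `σ ∈ Γ_ℚ`** — the condition "Kummer at the place of `ℚ_∞`
above `p`" is the same at all (i.e. the one) such places; the `p`-part of
`WeierstrassCurve.mem_selmerGroupOver_iff` for a class known to be Kummer at the chosen place.
[cite: GreenbergLNM1716, §2] [cite: SerreLocalFields1979, Ch. IV §4 Prop. 17, VII §5 Prop. 3] -/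
theorem conjH1_mem_localKerOver_of_mem (hκ : κ.IsCyclotomic) (hpv : ((p : ℕ) : 𝓞 ℚ) ∈ v.asIdeal)
    {c : W.subgroupH1 p κ.kerSubgroup}
    (hc : c ∈ W.localKerOver p κ.kerSubgroup (v.adicCompletion ℚ)) (σ : absoluteGaloisGroup ℚ) :
    W.conjH1 p κ.kerSubgroup σ c ∈ W.localKerOver p κ.kerSubgroup (v.adicCompletion ℚ) :=
  conjH1_mem_localKerOver_of_exists W p κ.kerSubgroup (v.adicCompletion ℚ) σ
    (exists_resGal_inv_mul_mem_kerSubgroup κ hκ hpv σ) hc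

/-- The same for every embedding `ι : ℚ̄ → ℚ̄_v` (`ι = closureEmb ∘ τ`, `localKerOverOfEmb_comp`):
`c ∈ localKerOver ℚ_v → c ∈ localKerOverOfEmb ι`. [cite: GreenbergLNM1716, §2] -/
theorem mem_localKerOverOfEmb_of_mem (hκ : κ.IsCyclotomic) (hpv : ((p : ℕ) : 𝓞 ℚ) ∈ v.asIdeal)
    {c : W.subgroupH1 p κ.kerSubgroup}
    (hc : c ∈ W.localKerOver p κ.kerSubgroup (v.adicCompletion ℚ))
    (ι : AlgebraicClosure ℚ →ₐ[ℚ] AlgebraicClosure (v.adicCompletion ℚ)) :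
    c ∈ W.localKerOverOfEmb p κ.kerSubgroup ι := by
  obtain ⟨τ, rfl⟩ := exists_algHom_eq_comp (closureEmb (K := ℚ) (v.adicCompletion ℚ)) ι
  rw [W.localKerOverOfEmb_comp p κ.kerSubgroup, AddSubgroup.mem_comap,
    ← WeierstrassCurve.localKerOver_eq_ofEmb]
  exact conjH1_mem_localKerOver_of_mem p κ W hκ hpv hc _

end Rat

end Summit.BirchSwinnertonDyer.Rank1Residual.X1.LocalKerOverAtPConj

end
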